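import Mathlib
import Summits.MatrixMultiplication.MatrixMultiplication.Theses.HiddenToeplitzCorners

/-!
# Stub `stub_transfer` — crux `HiddenCorners` (stmt-MatrixMultiplication-7492), line `ApolarSketch`

The ε / `∃ᶠ` bookkeeping half of the transfer "honest Hankel corners (C⁺, δ = 2) ⇒ `HiddenCorners`":
given the per-instance packaging `hinst` (every Hankel placement `W` yields a Toeplitz pencil with split
Stein generators of length `1`, generator sparsity at most `Σ_{k < 2N-1} nnz (W k)`, and the same singular
locus as the Hankel pencil `X ↦ [tr (X * W (i + j))]`) and C⁺(δ = 2) `hC`, the body of `HiddenCorners`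
follows with `d := 1`: restrict the frequently-many `r` to `r ≥ 1` (`Filter.Frequently.and_eventually`,
`Filter.eventually_ge_atTop`), so that `(1 : ℝ) ≤ r ^ ε` (`Real.one_le_rpow`), chain the sparsity bounds
through `Nat.cast_le`, and move `det ≠ 0` / `det = 0` across the `↔` of `hinst`.
-/

set_option linter.dupNamespace false

namespace Summit.MatrixMultiplication.MatrixMultiplication.Cruxes.HiddenCorners.ApolarSketch

open Summit.MatrixMultiplication.MatrixMultiplication.Theses.HiddenToeplitzCorners
open scoped BigOperators Matrix

/-- STUB 2 — transfer: the instance statement (`stub_instance`) and C⁺(δ = 2) (`stub_honest`) give the crux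
(conclusion = the body of `HiddenCorners`, verbatim, so that only `HiddenCorners_of` concludes the crux by name).
Bookkeeping only: from `∃ᶠ r` in C⁺ pass to `r ≥ 1` (`Filter.Frequently.and_eventually`, `Filter.eventually_ge_atTop`),
take the instance at `(r, N, W)`, `d := 1` (`(1 : ℝ) ≤ r ^ ε` by `Real.one_le_rpow`), chain the sparsity bounds through
`Nat.cast_le`, and move `det ≠ 0` / `det = 0` across the `↔`. -/
theorem stub_transfer
    (hinst : ∀ (r N : ℕ) (W : ℕ → Matrix (Fin r) (Fin r) ℂ),
      ∃ (T : Fin r → Fin r → Matrix (Fin N) (Fin N) ℂ) (G₀ H₀ : Matrix (Fin N) (Fin 1) ℂ)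
        (G₁ H₁ : Fin r → Fin r → Matrix (Fin N) (Fin 1) ℂ),
        (∀ a b : Fin r, T a b
            - (Matrix.of fun i j : Fin N => if (i : ℕ) = (j : ℕ) + 1 then (1 : ℂ) else 0) * T a b
              * (Matrix.of fun i j : Fin N => if (i : ℕ) = (j : ℕ) + 1 then (1 : ℂ) else 0)ᵀ
            = G₀ * (H₁ a b)ᵀ + G₁ a b * H₀ᵀ) ∧
        (∑ a : Fin r, ∑ b : Fin r,
            ((Finset.univ.filter fun p : Fin N × Fin 1 => G₁ a b p.1 p.2 ≠ 0).card
              + (Finset.univ.filter fun p : Fin N × Fin 1 => H₁ a b p.1 p.2 ≠ 0).card)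
          ≤ ∑ k ∈ Finset.range (2 * N - 1),
              (Finset.univ.filter fun p : Fin r × Fin r => W k p.1 p.2 ≠ 0).card) ∧
        ∀ X : Matrix (Fin r) (Fin r) ℂ,
          (∑ a : Fin r, ∑ b : Fin r, X a b • T a b).det = 0 ↔
            (Matrix.of fun i j : Fin N => (X * W ((i : ℕ) + (j : ℕ))).trace).det = 0)
    (hC : ∀ ε : ℝ, 0 < ε → ∃ᶠ r : ℕ in Filter.atTop, ∃ N : ℕ, (N : ℝ) ≤ (r : ℝ) ^ (2 + ε) ∧
      ∃ W : ℕ → Matrix (Fin r) (Fin r) ℂ, (∀ k, 2 * N - 1 ≤ k → W k = 0) ∧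
        (((∑ k ∈ Finset.range (2 * N - 1),
            (Finset.univ.filter fun p : Fin r × Fin r => W k p.1 p.2 ≠ 0).card : ℕ) : ℝ)
              ≤ (r : ℝ) ^ (2 + ε)) ∧
        (∃ X₀ : Matrix (Fin r) (Fin r) ℂ,
          (Matrix.of fun i j : Fin N => (X₀ * W ((i : ℕ) + (j : ℕ))).trace).det ≠ 0) ∧
        ∀ X : Matrix (Fin r) (Fin r) ℂ, X.det = 0 →
          (Matrix.of fun i j : Fin N => (X * W ((i : ℕ) + (j : ℕ))).trace).det = 0) :
    ∀ ε : ℝ, 0 < ε → ∃ᶠ r : ℕ in Filter.atTop, ∃ (N d : ℕ), (N : ℝ) ≤ (r : ℝ) ^ (2 + ε) ∧ (d : ℝ) ≤ (r : ℝ) ^ ε ∧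
      ∃ (T : Fin r → Fin r → Matrix (Fin N) (Fin N) ℂ) (G₀ H₀ : Matrix (Fin N) (Fin d) ℂ)
        (G₁ H₁ : Fin r → Fin r → Matrix (Fin N) (Fin d) ℂ),
        (∀ a b, T a b - (Matrix.of fun i j : Fin N => if (i : ℕ) = (j : ℕ) + 1 then (1 : ℂ) else 0) * T a b
            * (Matrix.of fun i j : Fin N => if (i : ℕ) = (j : ℕ) + 1 then (1 : ℂ) else 0)ᵀ
              = G₀ * (H₁ a b)ᵀ + G₁ a b * H₀ᵀ) ∧
        ((∑ a : Fin r, ∑ b : Fin r,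
            ((Finset.univ.filter fun p : Fin N × Fin d => G₁ a b p.1 p.2 ≠ 0).card
              + (Finset.univ.filter fun p : Fin N × Fin d => H₁ a b p.1 p.2 ≠ 0).card) : ℕ) : ℝ)
          ≤ (r : ℝ) ^ (2 + ε) ∧
        (∃ X₀ : Matrix (Fin r) (Fin r) ℂ, (∑ a : Fin r, ∑ b : Fin r, X₀ a b • T a b).det ≠ 0) ∧
        ∀ X : Matrix (Fin r) (Fin r) ℂ, X.det = 0 → (∑ a : Fin r, ∑ b : Fin r, X a b • T a b).det = 0 := by
  intro ε hε
  refine ((hC ε hε).and_eventually (Filter.eventually_ge_atTop 1)).mono ?_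
  rintro r ⟨⟨N, hN, W, -, hsp, ⟨X₀, hX₀⟩, hsing⟩, hr⟩
  obtain ⟨T, G₀, H₀, G₁, H₁, hdisp, hnnz, hdet⟩ := hinst r N W
  refine ⟨N, 1, hN, ?_, T, G₀, H₀, G₁, H₁, hdisp, ?_, ⟨X₀, fun h => hX₀ ((hdet X₀).mp h)⟩,
    fun X hX => (hdet X).mpr (hsing X hX)⟩
  · rw [Nat.cast_one]
    exact Real.one_le_rpow (by exact_mod_cast hr) hε.le
  · exact le_trans (by exact_mod_cast hnnz) hsp

end Summit.MatrixMultiplication.MatrixMultiplication.Cruxes.HiddenCorners.ApolarSketch
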